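import Summits.QuantumFields.YangMills.Theorems.UnitScaleTiltProp7QSymEqTrueLinIter
import Summits.QuantumFields.YangMills.Theorems.UnitScaleTiltProp7SymAvgTwOfRegPr
import HarnessLib

/-!
# Route `UnitScaleTilt`, crux K1 «MinimiserStabilityRegPr» (stmt-QuantumFields-19200), route-R E′ architecture (A′) «HCOW-VIA-Σ» (★★OWNER RULING g28-№13), package P-A1 «LEG
# LEMMA» FOR THE COMB-FRAMED CHART — `QTw_W A c = Q^{(K−n)}_W A ĉ − (r(c₋)A − Ū(ĉ)·r(c₊)A·Ū(ĉ)ᴴ)` with `r` the linearised CORNER-COMB frames `frameTw`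

Cell `ym3-torus`, D-0154 (3c) twin-width seat `ym-routeR-w2` (gen 7), 2026-08-29.  ★p1 g17 WORD 12 (S-i) («if the comb-framed chart `Prop7SymAvgTw.logChartTw` (frames `wrec`) is the one whose
zero set IS ✓p687911's Σ, P-A1∕P-A2 should be cut on `logChartTw`∕`QTw` (LEG: `Q_W − QTw = D_V̄∘S_comb`)»); the TwS twin is ✓ `Prop7QSymEqTrueLinIter.QTwS_apply_eq_trueLinIter_sub_coarseGauge`
(p688288).  THEOREMS ONLY (0 `def`, 0 `sorry`); `--supports stmt-QuantumFields-19200 --as helper`, count-neutral.  YM₃ on T³ is a ladder rung (R3), not the Clay problem; nothing here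
claims the stub, the crux, `hcoW`, E′, EX, d = 4 or the mass gap.

WHAT IS PROVED (ns `…Theorems.Prop7LegLemmaQTw`; T³, `SU(2)`).
* ★★★ `QTw_apply_eq_trueLinIter_sub_coarseGauge` — at a printed-regular `W` (`RegPr F n K ε₀ W`, `10¹⁰L⁶ε₀ ≤ 1`, the comb frames' three numeric windows `hα3 hα4 hexp` at `α₀ = 2ε₀` as
  displayed by ✓ `Prop7SymAvgTwOfRegPr.QTw_apply_eq_of_regPr`), for the E′ recursion family `Q` and every 𝔰𝔲(2)-valued `A`:
  `QTw F n K h W A c = Q (K−n) A ĉ − (r c.src A − ↑(Ū ĉ)·r c.tgt A·(↑(Ū ĉ))ᴴ)`, `r y := fderiv ℂ (A ↦ ↑(frameTw W A y)) 0`, `Ū = avg^{K−n} W`, `ĉ = bondShift (sites_eq F n K h) c` —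
  ✓ `QTw_apply_eq_of_regPr` ∘ ✓ «QSYM = Q» ∘ ✓ `coe_descendToGL_bgUnits(_inv)`.
HONEST SCOPE.  A three-line corollary of landed theorems; no estimate.

References: T. Bałaban, CMP 98 (1985) 17–51 [Balaban1985Averaging] ((89)–(92) p.31, (97) p.32, (125)–(127) p.36); CMP 99 (1985) 389–434 [Balaban1985BackgroundPropagators]
((3.14)–(3.15), (3.19) p.393); CMP 102 (1985) 277–309 [Balaban1985Variational] ((44)–(48) p.285).
-/

set_option autoImplicit false

noncomputable section

open scoped BigOperators Matrix.Norms.L2Operator Topology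

namespace Summit.QuantumFields.YangMills.Theorems.Prop7LegLemmaQTw

open Literature.MathematicalPhysics.QuantumFieldTheory.Balaban1983to89
open Literature.MathematicalPhysics.QuantumFieldTheory.Balaban1983to89.T3ContinuumYM3Torus
open T4Continuum BlockAveraging AveragingRT ExpMeanLog BlockAveragingEMLLinearised BlockAveragingEMLLinearisedBackground BlockAveragingEMLProp2
open T3PrintedRegularMinimiser (RegPr)
open T3LevelShift (bondShift)
open T3PrintedRegularOrbits (sites_eq)
open B7Prop2Explicit (C0 c2')
open Summit.QuantumFields.YangMills.Theorems.Prop7SymAvgTw (frameTw QTw)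
open Summit.QuantumFields.YangMills.Theorems.Prop7SymAvgTwOfRegPr (QTw_apply_eq_of_regPr)
open Summit.QuantumFields.YangMills.Theorems.Prop7QSymEqTrueLinIter (QSym_apply_eq_trueLinIter coe_descendToGL_bgUnits coe_descendToGL_bgUnits_inv)

variable (F : T3Family) {n K : ℕ} (h : n ≤ K)

/-- ★★★ **P-A1 «LEG LEMMA» FOR THE COMB-FRAMED CHART, IN E′ LETTERS.**  At a printed-regular `W` (with the comb frames' displayed windows), for the E′ recursion family `Q` and
every 𝔰𝔲(2)-valued `A`: `QTw F n K h W A c = Q (K−n) A ĉ − (r c.src A − ↑(Ū ĉ)·r c.tgt A·(↑(Ū ĉ))ᴴ)` with `r y := fderiv ℂ (A ↦ ↑(frameTw W A y)) 0` — the comb twin of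
✓ `QTwS_apply_eq_trueLinIter_sub_coarseGauge`: `Q_W − QTw_W` is the coarse pure gauge `D_Ū(r(·)A)`.
[cite: Balaban1985Averaging, (125)-(127) p.36, (89)-(92) p.31, (97) p.32; Balaban1985BackgroundPropagators, (3.14)-(3.15), (3.19) p.393; Balaban1985Variational, (44)-(48) p.285] -/
theorem QTw_apply_eq_trueLinIter_sub_coarseGauge {ε₀ : ℝ} (hε₀ : 0 < ε₀) (hε : 10 ^ 10 * (F.L : ℝ) ^ 6 * ε₀ ≤ 1)
    (hα3 : C0 (F.P K).d * (2 * ε₀) ≤ 1 / 3) (hα4 : 4 * (2 * ε₀) ≤ c2' (F.P K).d (F.P K).L)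
    (hexp : Real.exp (4 * (800 * (((F.P K).d : ℝ) + 1) ^ 2 * (((F.P K).d : ℝ) + 4)) * (2 * ε₀)) < 2)
    (W : GaugeField (F.P K) 0 (Matrix.specialUnitaryGroup (Fin 2) ℂ)) (hreg : RegPr F n K ε₀ W)
    (Q : (k : ℕ) → (PBond (F.P K) 0 → Matrix (Fin 2) (Fin 2) ℂ) → PBond (F.P K) k → Matrix (Fin 2) (Fin 2) ℂ) (hQ0 : ∀ Y, Q 0 Y = Y)
    (hQs : ∀ (k : ℕ) (Y : PBond (F.P K) 0 → Matrix (Fin 2) (Fin 2) ℂ) (c : PBond (F.P K) (k + 1)), Q (k + 1) Y c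
      = fderiv ℂ (eml : (Idx (F.P K) → Matrix (Fin 2) (Fin 2) ℂ) → Matrix (Fin 2) (Fin 2) ℂ)
            (fun i => ((loopHol (Averaging.iter (fun i => blockAvg (P := F.P K) (j := i) (expMeanLogSU (n := Fin 2))) k W) c i :
              Matrix.specialUnitaryGroup (Fin 2) ℂ) : Matrix (Fin 2) (Fin 2) ℂ))
            (fun i => covWalkSum (Averaging.iter (fun i => blockAvg (P := F.P K) (j := i) (expMeanLogSU (n := Fin 2))) k W) (Q k Y)
                (walk (emb c.src) (loopWord (F.P K).L c.dir (off i.1) i.2.1 i.2.2))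
              * ((loopHol (Averaging.iter (fun i => blockAvg (P := F.P K) (j := i) (expMeanLogSU (n := Fin 2))) k W) c i :
                Matrix.specialUnitaryGroup (Fin 2) ℂ) : Matrix (Fin 2) (Fin 2) ℂ))
            * star ((corr (expMeanLogSU (n := Fin 2)) (Averaging.iter (fun i => blockAvg (P := F.P K) (j := i) (expMeanLogSU (n := Fin 2))) k W) c :
                Matrix.specialUnitaryGroup (Fin 2) ℂ) : Matrix (Fin 2) (Fin 2) ℂ)
          + ((corr (expMeanLogSU (n := Fin 2)) (Averaging.iter (fun i => blockAvg (P := F.P K) (j := i) (expMeanLogSU (n := Fin 2))) k W) c :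
                Matrix.specialUnitaryGroup (Fin 2) ℂ) : Matrix (Fin 2) (Fin 2) ℂ)
            * covWalkSum (Averaging.iter (fun i => blockAvg (P := F.P K) (j := i) (expMeanLogSU (n := Fin 2))) k W) (Q k Y)
                (walk (emb c.src) (List.replicate (F.P K).L (c.dir, true)))
            * star ((corr (expMeanLogSU (n := Fin 2)) (Averaging.iter (fun i => blockAvg (P := F.P K) (j := i) (expMeanLogSU (n := Fin 2))) k W) c :
                Matrix.specialUnitaryGroup (Fin 2) ℂ) : Matrix (Fin 2) (Fin 2) ℂ))
    (A : PBond (F.P K) 0 → Matrix (Fin 2) (Fin 2) ℂ) (hA : ∀ b, A b ∈ skewAdjoint (Matrix (Fin 2) (Fin 2) ℂ)) (htr : ∀ b, (A b).trace = 0)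
    (c : PBond (F.P n) 0) :
    QTw F n K h W A c
      = Q (K - n) A (bondShift (sites_eq F n K h) c)
        - (fderiv ℂ (fun A : PBond (F.P K) 0 → Matrix (Fin 2) (Fin 2) ℂ => ((frameTw F n K h W A c.src : (Matrix (Fin 2) (Fin 2) ℂ)ˣ) : Matrix (Fin 2) (Fin 2) ℂ)) 0 A
            - ((Averaging.iter (fun i => blockAvg (P := F.P K) (j := i) (expMeanLogSU (n := Fin 2))) (K - n) W (bondShift (sites_eq F n K h) c) :
                Matrix.specialUnitaryGroup (Fin 2) ℂ) : Matrix (Fin 2) (Fin 2) ℂ)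
              * fderiv ℂ (fun A : PBond (F.P K) 0 → Matrix (Fin 2) (Fin 2) ℂ => ((frameTw F n K h W A c.tgt : (Matrix (Fin 2) (Fin 2) ℂ)ˣ) : Matrix (Fin 2) (Fin 2) ℂ)) 0 A
              * star ((Averaging.iter (fun i => blockAvg (P := F.P K) (j := i) (expMeanLogSU (n := Fin 2))) (K - n) W (bondShift (sites_eq F n K h) c) :
                Matrix.specialUnitaryGroup (Fin 2) ℂ) : Matrix (Fin 2) (Fin 2) ℂ)) := by
  -- windows
  have hL3 : (3 : ℝ) ≤ (F.L : ℝ) := by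
    have h3 : 3 ≤ F.L := by obtain ⟨a, ha⟩ := F.hL.1; have := F.hL.2; omega
    exact_mod_cast h3
  have hL1 : (1 : ℝ) ≤ (F.L : ℝ) := by linarith
  have hε7 : 10 ^ 7 * (F.L : ℝ) ^ 3 * ε₀ ≤ 1 := by
    have h36 : (F.L : ℝ) ^ 3 ≤ (F.L : ℝ) ^ 6 := pow_le_pow_right₀ hL1 (by norm_num)
    nlinarith [h36, hε₀.le, pow_nonneg (zero_le_one.trans hL1) 3]
  rw [QTw_apply_eq_of_regPr F h hε₀ hε7 hα3 hα4 hexp W hreg A c, QSym_apply_eq_trueLinIter F h hε₀ hε W hreg Q hQ0 hQs A hA htr c,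
    coe_descendToGL_bgUnits F h hε₀ hε7 W hreg.1 c, coe_descendToGL_bgUnits_inv F h hε₀ hε7 W hreg.1 c]

/-! ## §2 (v1.1) The comb frames' three windows at the cell's standing smallness; LEG-COMB with no window displayed -/

/-- **THE COMB FRAMES' THREE NUMERIC WINDOWS FROM `10⁷L³ε₀ ≤ 1`** (at `d = 3`: `C₀ = 226·(8·4·7)² = 11339776`, `c₂′ = 1∕(14336L²)`, and the exponent of the third window is
`4·(800·16·7)·(2ε₀) = 716800·ε₀ ≤ 0.003`, so `exp(·) ≤ 1 + 2·0.003 < 2`) — the twin of ✓ `Prop7SymSliceWitness.windows_of_ten7` plus the exponential row, inlined.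
[cite: Balaban1985Averaging, Prop. 2 (52)–(54) p.26, Prop. 4 p.38] -/
theorem comb_windows_of_ten7 {ε₀ : ℝ} (hε₀ : 0 ≤ ε₀) (hε : 10 ^ 7 * (F.L : ℝ) ^ 3 * ε₀ ≤ 1) :
    C0 (F.P K).d * (2 * ε₀) ≤ 1 / 3 ∧ 4 * (2 * ε₀) ≤ c2' (F.P K).d (F.P K).L ∧
      Real.exp (4 * (800 * (((F.P K).d : ℝ) + 1) ^ 2 * (((F.P K).d : ℝ) + 4)) * (2 * ε₀)) < 2 := by
  have hL : (3 : ℝ) ≤ F.L := by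
    have h3 : 3 ≤ F.L := by obtain ⟨a, ha⟩ := F.hL.1; have := F.hL.2; omega
    exact_mod_cast h3
  have hd : (F.P K).d = 3 := T3Family.P_d F K
  have hPL : (F.P K).L = F.L := rfl
  rw [hd, hPL]
  have hL3 : (27 : ℝ) ≤ (F.L : ℝ) ^ 3 := by
    have h := pow_le_pow_left₀ (by norm_num : (0 : ℝ) ≤ 3) hL 3
    norm_num at h
    exact h
  -- `27·10⁷·ε₀ ≤ 1`
  have hεb : 27 * (10 ^ 7 * ε₀) ≤ 1 :=
    le_trans (by nlinarith [mul_le_mul_of_nonneg_right hL3 (by positivity : (0 : ℝ) ≤ 10 ^ 7 * ε₀)]) hε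
  -- `3·10⁷·L²·ε₀ ≤ 1`
  have h2 : 3 * (10 ^ 7 * (F.L : ℝ) ^ 2 * ε₀) ≤ 1 :=
    calc 3 * (10 ^ 7 * (F.L : ℝ) ^ 2 * ε₀) ≤ (F.L : ℝ) * (10 ^ 7 * (F.L : ℝ) ^ 2 * ε₀) :=
          mul_le_mul_of_nonneg_right hL (by positivity)
      _ = 10 ^ 7 * (F.L : ℝ) ^ 3 * ε₀ := by ring
      _ ≤ 1 := hε
  refine ⟨?_, ?_, ?_⟩
  · have hC : C0 3 = 11339776 := by simp only [C0]; norm_num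
    rw [hC]
    linarith
  · have hc : c2' 3 F.L = 1 / (14336 * (F.L : ℝ) ^ 2) := by simp only [c2']; norm_num
    have hL2 : (0 : ℝ) < 14336 * (F.L : ℝ) ^ 2 := by positivity
    rw [hc, le_div_iff₀ hL2]
    nlinarith [h2]
  · have hx : (4 * (800 * (((3 : ℕ) : ℝ) + 1) ^ 2 * (((3 : ℕ) : ℝ) + 4)) * (2 * ε₀)) = 716800 * ε₀ := by push_cast; ring
    rw [hx]
    have hx0 : 0 ≤ 716800 * ε₀ := by positivity
    have hx1 : 716800 * ε₀ ≤ 3 / 1000 := by linarith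
    have habs : |716800 * ε₀| ≤ 1 := by rw [abs_of_nonneg hx0]; linarith
    have hb := Real.abs_exp_sub_one_le habs
    rw [abs_of_nonneg hx0] at hb
    have hb' := (abs_le.1 hb).2
    linarith

/-- ★★★ **P-A1 «LEG LEMMA» FOR THE COMB-FRAMED CHART, NO WINDOW DISPLAYED.**  At a printed-regular `W` (`RegPr F n K ε₀ W`, `10¹⁰L⁶ε₀ ≤ 1`), for the E′ recursion family
`Q` and every 𝔰𝔲(2)-valued `A`: `QTw F n K h W A c = Q (K−n) A ĉ − (r c.src A − ↑(Ū ĉ)·r c.tgt A·(↑(Ū ĉ))ᴴ)`, `r y := fderiv ℂ (A ↦ ↑(frameTw W A y)) 0` — §1 with the comb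
frames' three windows discharged by `comb_windows_of_ten7` (the shape the (A′) assembler reads at a `RegPr (α L)` member without owing `hα3 hα4 hexp`).
[cite: Balaban1985Averaging, (125)-(127) p.36, (89)-(92) p.31, (97) p.32, Prop. 2 (52)-(54) p.26; Balaban1985BackgroundPropagators, (3.14)-(3.15), (3.19) p.393; Balaban1985Variational, (44)-(48) p.285] -/
theorem QTw_apply_eq_trueLinIter_sub_coarseGauge_T3 {ε₀ : ℝ} (hε₀ : 0 < ε₀) (hε : 10 ^ 10 * (F.L : ℝ) ^ 6 * ε₀ ≤ 1)
    (W : GaugeField (F.P K) 0 (Matrix.specialUnitaryGroup (Fin 2) ℂ)) (hreg : RegPr F n K ε₀ W)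
    (Q : (k : ℕ) → (PBond (F.P K) 0 → Matrix (Fin 2) (Fin 2) ℂ) → PBond (F.P K) k → Matrix (Fin 2) (Fin 2) ℂ) (hQ0 : ∀ Y, Q 0 Y = Y)
    (hQs : ∀ (k : ℕ) (Y : PBond (F.P K) 0 → Matrix (Fin 2) (Fin 2) ℂ) (c : PBond (F.P K) (k + 1)), Q (k + 1) Y c
      = fderiv ℂ (eml : (Idx (F.P K) → Matrix (Fin 2) (Fin 2) ℂ) → Matrix (Fin 2) (Fin 2) ℂ)
            (fun i => ((loopHol (Averaging.iter (fun i => blockAvg (P := F.P K) (j := i) (expMeanLogSU (n := Fin 2))) k W) c i :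
              Matrix.specialUnitaryGroup (Fin 2) ℂ) : Matrix (Fin 2) (Fin 2) ℂ))
            (fun i => covWalkSum (Averaging.iter (fun i => blockAvg (P := F.P K) (j := i) (expMeanLogSU (n := Fin 2))) k W) (Q k Y)
                (walk (emb c.src) (loopWord (F.P K).L c.dir (off i.1) i.2.1 i.2.2))
              * ((loopHol (Averaging.iter (fun i => blockAvg (P := F.P K) (j := i) (expMeanLogSU (n := Fin 2))) k W) c i :
                Matrix.specialUnitaryGroup (Fin 2) ℂ) : Matrix (Fin 2) (Fin 2) ℂ))
            * star ((corr (expMeanLogSU (n := Fin 2)) (Averaging.iter (fun i => blockAvg (P := F.P K) (j := i) (expMeanLogSU (n := Fin 2))) k W) c :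
                Matrix.specialUnitaryGroup (Fin 2) ℂ) : Matrix (Fin 2) (Fin 2) ℂ)
          + ((corr (expMeanLogSU (n := Fin 2)) (Averaging.iter (fun i => blockAvg (P := F.P K) (j := i) (expMeanLogSU (n := Fin 2))) k W) c :
                Matrix.specialUnitaryGroup (Fin 2) ℂ) : Matrix (Fin 2) (Fin 2) ℂ)
            * covWalkSum (Averaging.iter (fun i => blockAvg (P := F.P K) (j := i) (expMeanLogSU (n := Fin 2))) k W) (Q k Y)
                (walk (emb c.src) (List.replicate (F.P K).L (c.dir, true)))
            * star ((corr (expMeanLogSU (n := Fin 2)) (Averaging.iter (fun i => blockAvg (P := F.P K) (j := i) (expMeanLogSU (n := Fin 2))) k W) c :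
                Matrix.specialUnitaryGroup (Fin 2) ℂ) : Matrix (Fin 2) (Fin 2) ℂ))
    (A : PBond (F.P K) 0 → Matrix (Fin 2) (Fin 2) ℂ) (hA : ∀ b, A b ∈ skewAdjoint (Matrix (Fin 2) (Fin 2) ℂ)) (htr : ∀ b, (A b).trace = 0)
    (c : PBond (F.P n) 0) :
    QTw F n K h W A c
      = Q (K - n) A (bondShift (sites_eq F n K h) c)
        - (fderiv ℂ (fun A : PBond (F.P K) 0 → Matrix (Fin 2) (Fin 2) ℂ => ((frameTw F n K h W A c.src : (Matrix (Fin 2) (Fin 2) ℂ)ˣ) : Matrix (Fin 2) (Fin 2) ℂ)) 0 A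
            - ((Averaging.iter (fun i => blockAvg (P := F.P K) (j := i) (expMeanLogSU (n := Fin 2))) (K - n) W (bondShift (sites_eq F n K h) c) :
                Matrix.specialUnitaryGroup (Fin 2) ℂ) : Matrix (Fin 2) (Fin 2) ℂ)
              * fderiv ℂ (fun A : PBond (F.P K) 0 → Matrix (Fin 2) (Fin 2) ℂ => ((frameTw F n K h W A c.tgt : (Matrix (Fin 2) (Fin 2) ℂ)ˣ) : Matrix (Fin 2) (Fin 2) ℂ)) 0 A
              * star ((Averaging.iter (fun i => blockAvg (P := F.P K) (j := i) (expMeanLogSU (n := Fin 2))) (K - n) W (bondShift (sites_eq F n K h) c) :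
                Matrix.specialUnitaryGroup (Fin 2) ℂ) : Matrix (Fin 2) (Fin 2) ℂ)) := by
  -- windows
  have hL3 : (3 : ℝ) ≤ (F.L : ℝ) := by
    have h3 : 3 ≤ F.L := by obtain ⟨a, ha⟩ := F.hL.1; have := F.hL.2; omega
    exact_mod_cast h3
  have hL1 : (1 : ℝ) ≤ (F.L : ℝ) := by linarith
  have hε7 : 10 ^ 7 * (F.L : ℝ) ^ 3 * ε₀ ≤ 1 := by
    have h36 : (F.L : ℝ) ^ 3 ≤ (F.L : ℝ) ^ 6 := pow_le_pow_right₀ hL1 (by norm_num)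
    nlinarith [h36, hε₀.le, pow_nonneg (zero_le_one.trans hL1) 3]
  obtain ⟨hα3, hα4, hexp⟩ := comb_windows_of_ten7 F (K := K) hε₀.le hε7
  exact QTw_apply_eq_trueLinIter_sub_coarseGauge F h hε₀ hε hα3 hα4 hexp W hreg Q hQ0 hQs A hA htr c

end Summit.QuantumFields.YangMills.Theorems.Prop7LegLemmaQTw

end
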